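import Mathlib
import Literature.Analysis.FunctionSpaces.PlancherelL1L2
import Summits.NavierStokesRegularity.NavierStokesRegularity.Theorems.FilamentSkeletonRssClause13SmoothingKernelPlancherel

/-!
# Clause 13-J, brick B4-core (ii): the SPECTRAL FORM of the model self operator,
# `(2/q)∫|f|² − ∫∫ K_q(t−u) f(u) conj f(t) = (1/2π) ∫ (2/q)·𝔖(z√q) |∫ f(x)e^{izx}dx|² dz`

Route `FilamentSkeletonRss`, child 28296 `Clause13NearStraight` (and its A1L twin); design of record
`filament-plan/DESIGN-NOTE-28296-tenure-g22.md` §4–§5 ("global L² estimate first (quadratic forms: … −𝔖(μD) … via Plancherel)").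
The Taylor-remainder operator of B2 is `M_q f = (2/q) f − K_q∗f` (`taylorRemainderOp_eq`); combining the kernel Plancherel form
(`integral_integral_smoothingKernel_sub`, p665209) with Plancherel for `f ∈ L¹ ∩ L²` (tree `Literature.Analysis.FunctionSpaces.
integral_norm_sq_fourierIntegral_eq`) gives the quadratic form of `M_q` as the spectral integral with the symbol `(2/q)𝔖(z√q)`
(`modelSelfForm_eq_spectral`); `continuous_liaSym` (continuity of `𝔖`, read off the continuity of `𝓕K_q`) is recorded on the way.
Typing-agnostic.  Lane ns-filament-19175-p1 g13; `--supports stmt-NavierStokesRegularity-28296 --as helper`.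
HONEST FRAMING: harmonic analysis of an explicit model operator attached to a HYPOTHETICAL filament skeleton on the NEGATIVE side of a
MODEL route; nothing here bears on Navier–Stokes regularity or blow-up.
-/

noncomputable section

open MeasureTheory Real Complex Filter
open scoped FourierTransform ComplexConjugate
open Summit.NavierStokesRegularity.NavierStokesRegularity.Theorems.AnalyticStripLiaSymbol (liaSym liaSym_neg liaSym_zero
  one_sub_liaSym_nonneg one_sub_liaSym_le_exp)

namespace Summit.NavierStokesRegularity.NavierStokesRegularity.Theorems.MatchedKernel
set_option linter.dupNamespace false

/-- **Continuity of `𝔖`**, read off `𝓕K_1(w) = 2(1 − 𝔖(2πw))` and the continuity of the Fourier transform of an `L¹` kernel. [folklore] -/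
theorem continuous_liaSym : Continuous liaSym := by
  have hcont : Continuous (𝓕 (fun s : ℝ => (((2 * 1 - s ^ 2) * ((s ^ 2 + 1) ^ (5 / 2 : ℝ))⁻¹ : ℝ) : ℂ))) :=
    VectorFourier.fourierIntegral_continuous Real.continuous_fourierChar continuous_inner
      (integrable_smoothingKernel one_pos)
  have hre : Continuous (fun w : ℝ => (𝓕 (fun s : ℝ => (((2 * 1 - s ^ 2) * ((s ^ 2 + 1) ^ (5 / 2 : ℝ))⁻¹ : ℝ) : ℂ)) w).re) :=
    Complex.continuous_re.comp hcont
  have hfun : liaSym = fun x => 1 - (𝓕 (fun s : ℝ => (((2 * 1 - s ^ 2) * ((s ^ 2 + 1) ^ (5 / 2 : ℝ))⁻¹ : ℝ) : ℂ))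
      (x / (2 * π))).re / 2 := by
    funext x
    rw [fourier_smoothingKernel one_pos, Complex.ofReal_re, Real.sqrt_one, mul_one,
      show 2 * π * (x / (2 * π)) = x by field_simp]
    ring
  rw [hfun]
  exact (continuous_const.sub ((hre.comp (continuous_id.div_const _)).div_const _))

/-- `conj z · z = ‖z‖²` pointwise, integrated: `∫ conj f · f = ∫ ‖f‖²`. [folklore] -/
theorem integral_conj_mul_self (f : ℝ → ℂ) : ∫ t : ℝ, conj (f t) * f t = ((∫ t : ℝ, ‖f t‖ ^ 2 : ℝ) : ℂ) := by
  rw [← integral_complex_ofReal]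
  refine integral_congr_ae (Eventually.of_forall fun t => ?_)
  dsimp only
  rw [Complex.conj_mul', Complex.ofReal_pow]

/-- `∫ ‖𝓕 f ξ‖² dξ = (1/2π) ∫ |∫ f(x) e^{izx} dx|² dz` (Mathlib's `𝓕` versus the un-normalised transform). [folklore] -/
theorem integral_norm_sq_fourier_eq_unnormalised (f : ℝ → ℂ) :
    ∫ ξ : ℝ, ‖𝓕 f ξ‖ ^ 2 = 1 / (2 * π) * ∫ z : ℝ, ‖∫ x : ℝ, f x * cexp (I * z * x)‖ ^ 2 := by
  have hpt : ∀ ξ : ℝ, 𝓕 f ξ = (fun z : ℝ => ∫ x : ℝ, f x * cexp (I * z * x)) ((-(2 * π)) * ξ) := by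
    intro ξ
    rw [Real.fourier_real_eq_integral_exp_smul]
    refine integral_congr_ae (Eventually.of_forall fun x => ?_)
    dsimp only
    rw [smul_eq_mul, mul_comm]
    congr 2
    push_cast
    ring
  simp_rw [hpt]
  rw [MeasureTheory.Measure.integral_comp_mul_left (fun z : ℝ => ‖∫ x : ℝ, f x * cexp (I * z * x)‖ ^ 2) (-(2 * π))]
  rw [smul_eq_mul, inv_neg, abs_neg, abs_of_pos (by positivity)]
  ring

/-- **The spectral form of the model self operator.**  For `f ∈ L¹ ∩ L²(ℝ; ℂ)` and `q > 0`:
`(2/q)∫ conj f·f − ∫∫ K_q(t−u) f(u) conj f(t) du dt = (1/2π)∫ (2/q)𝔖(z√q) |∫ f(x)e^{izx}dx|² dz` — the quadratic form of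
`M_q = (2/q)·I − K_q∗` (B2) is the spectral integral with symbol `(2/q)𝔖(z√q)` (negative on `|z|√q < x*`, positive beyond). [folklore] -/
theorem modelSelfForm_eq_spectral {q : ℝ} (hq : 0 < q) {f : ℝ → ℂ} (hf : Integrable f) (hf2 : MemLp f 2) :
    (2 / q : ℂ) * (∫ t : ℝ, conj (f t) * f t)
      - ∫ t : ℝ, ∫ u : ℝ, ((((2 * q - (t - u) ^ 2) * (((t - u) ^ 2 + q) ^ (5 / 2 : ℝ))⁻¹ : ℝ)) : ℂ) * f u * conj (f t)
      = ((1 / (2 * π) * ∫ z : ℝ,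
          (2 / q * liaSym (z * √q)) * ‖∫ x : ℝ, f x * cexp (I * z * x)‖ ^ 2 : ℝ) : ℂ) := by
  rw [integral_conj_mul_self, integral_integral_smoothingKernel_sub_eq_ofReal hq hf,
    ← Literature.Analysis.FunctionSpaces.integral_norm_sq_fourierIntegral_eq hf hf2,
    integral_norm_sq_fourier_eq_unnormalised]
  -- integrability of the two spectral densities
  set F : ℝ → ℝ := fun z => ‖∫ x : ℝ, f x * cexp (I * z * x)‖ ^ 2 with hFdef
  have hFint : Integrable F := by
    -- `‖𝓕 f‖²` is integrable (Plancherel) and `F(z) = ‖𝓕 f(−z/2π)‖²`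
    have h𝓕 : Integrable (fun ξ : ℝ => ‖𝓕 f ξ‖ ^ 2) :=
      (memLp_two_iff_integrable_sq_norm (Literature.Analysis.FunctionSpaces.memLp_two_fourierIntegral hf hf2).1).1
        (Literature.Analysis.FunctionSpaces.memLp_two_fourierIntegral hf hf2)
    have hpt : ∀ ξ : ℝ, ‖𝓕 f ξ‖ ^ 2 = F ((-(2 * π)) * ξ) := by
      intro ξ
      simp only [hFdef]
      congr 2
      rw [Real.fourier_real_eq_integral_exp_smul]
      refine integral_congr_ae (Eventually.of_forall fun x => ?_)
      dsimp only
      rw [smul_eq_mul, mul_comm]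
      congr 2
      push_cast
      ring
    have h1 : Integrable (fun ξ : ℝ => F ((-(2 * π)) * ξ)) := h𝓕.congr (Eventually.of_forall hpt)
    have hne : (-(2 * π))⁻¹ ≠ (0:ℝ) := inv_ne_zero (neg_ne_zero.mpr (by positivity))
    have h2 := h1.comp_mul_left' (R := (-(2 * π))⁻¹) hne
    refine h2.congr (Eventually.of_forall fun z => ?_)
    dsimp only
    congr 1
    field_simp
  have hm : Continuous (fun z : ℝ => 2 / q * (1 - liaSym (z * √q))) :=
    continuous_const.mul (continuous_const.sub (continuous_liaSym.comp (continuous_id.mul continuous_const)))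
  have hmF : Integrable (fun z : ℝ => (2 / q * (1 - liaSym (z * √q))) * F z) := by
    refine hFint.bdd_mul hm.aestronglyMeasurable (c := 10 / q) (Eventually.of_forall fun z => ?_)
    have h := norm_multiplier_le hq (z / (2 * π))
    rw [show 2 * π * (z / (2 * π)) * √q = z * √q by field_simp, Complex.norm_real] at h
    refine h.trans ?_
    have : Real.exp (-(π * √q * |z / (2 * π)|)) ≤ 1 := by
      rw [Real.exp_le_one_iff]; exact neg_nonpos.mpr (by positivity)
    calc 10 / q * Real.exp (-(π * √q * |z / (2 * π)|)) ≤ 10 / q * 1 := by gcongr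
      _ = 10 / q := mul_one _
  have key : ∫ z : ℝ, (2 / q * liaSym (z * √q)) * F z
      = 2 / q * (∫ z : ℝ, F z) - ∫ z : ℝ, (2 / q * (1 - liaSym (z * √q))) * F z := by
    rw [← integral_const_mul, ← integral_sub (hFint.const_mul _) hmF]
    refine integral_congr_ae (Eventually.of_forall fun z => ?_)
    dsimp only
    ring
  have hcast : (2 / q : ℂ) = ((2 / q : ℝ) : ℂ) := by push_cast; rfl
  rw [hcast, key, ← Complex.ofReal_mul, ← Complex.ofReal_sub]
  congr 1
  ring

end Summit.NavierStokesRegularity.NavierStokesRegularity.Theorems.MatchedKernel
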